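import Literature.Topology.FourManifolds.HandlebodyKernelExtensionGenusOne
import Summits.SmoothPoincare4.SmoothPoincare4.Theses.CongruenceShadows
import Summits.SmoothPoincare4.SmoothPoincare4.Theses.GroupTrisection

/-!
# SmoothPoincare4 / CongruenceShadows — `GriffithsHandlebodyExtension` (item stmt-SmoothPoincare4-15190): the support item against the Literature seat of Griffiths' theorem

The support item `GriffithsHandlebodyExtension` of route CongruenceShadows (and, verbatim, of route
GroupTrisection) is Griffiths' handlebody extension theorem in its smooth exact-restriction form:
for a genus-`g` handlebody `H` with any boundary datum `b`, a self-diffeomorphism `ψ` of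
`∂H = b.carrier` whose induced map on `π₁(∂H, x₀)` carries `ker (π₁ ∂H → π₁ H)` onto the kernel at
`ψ x₀` extends to a self-diffeomorphism of `H` (H. B. Griffiths, *Automorphisms of a
3-dimensional handlebody*, Abh. Math. Sem. Univ. Hamburg 26 (1964), main theorem; S. Hensel,
*A primer on handlebody groups* (2020), Cor. 5.11).  The statement is, up to notation, the body
of the Literature named fact `Literature.Topology.FourManifolds.GriffithsExtension`
(`HandlebodyKernelExtension.lean`), on which four Literature files already build
(`HandlebodyKernelExtensionProofs/Model/GenusOne.lean`, `TorusMappingClassFaithful.lean`).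

This file does NOT settle the item.  It records, against the ROUTE DECLS themselves (both Theses
copies), everything the Literature seat of the fact currently gives, so that the item closes by a
one-line theorem the moment the fact is discharged and so that the gate's audit shows the exact
trust base of each conditional form:

* `griffithsHandlebodyExtension_iff_griffithsExtension`,
  `groupTrisection_griffithsHandlebodyExtension_iff_griffithsExtension` — both route decls are
  definitionally the named fact (`Iff.rfl`);
* `griffithsHandlebodyExtension_of_griffithsExtension` (and the GroupTrisection twin) — the item
  from the fact (`id`): a Literature-side `GriffithsExtension_holds` closes the item at once;
* `griffithsHandlebodyExtension_of_waldhausen_of_sumS1S2` — LINE A (doubling), conditional on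
  `waldhausen_heegaardSplitting_sumS1S2_unique` (Waldhausen 1968 = Meier–Schirmer–Zupan Thm. 2.7)
  and `diffeomorph_sumS1S2_of_isFreeOfRank_fundamentalGroup` (Kneser–Stallings–Perelman), the two
  inputs of crux WaldhausenPairs;
* `griffithsHandlebodyExtension_of_faithful_of_flower` — LINE B/C split by genus: genus `0` is
  proved (`Γ₃ = 0`), genus `1` rests on the faithfulness of `Mod(T²)` on `π₁` (hypothesis (F), the
  model form of the named fact `Literature.Topology.FourManifolds.TorusMappingClassFaithful`,
  Farb–Margalit Thm. 2.5, injectivity of `Mod(T²) → SL(2, ℤ)`; the version quoting the named fact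
  is appended once `TorusMappingClassFaithful.lean` is built on the farm), and genus `≥ 2` on
  Griffiths' criterion for the flower handlebodies `FlowerModel.FlowerHandlebody` (Dehn's lemma
  line; no named fact);
* `griffithsHandlebodyExtension_genus_le_one_of_faithful` — the genus-`≤ 1` clauses of the item
  from (F) alone.

References: [GriffithsHB1964Handlebody] main theorem; [Hensel2020HandlebodyPrimer] Cor. 5.11,
Lemma 5.10; [FarbMargalit2012] Thm. 2.5; [MeierSchirmerZupan2016] Thm. 2.7; [AbramsGayKirby2018]
p. 4.
-/

-- the registered namespace `Summit.SmoothPoincare4.SmoothPoincare4.Theorems` repeats a component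
set_option linter.dupNamespace false

noncomputable section

namespace Summit.SmoothPoincare4.SmoothPoincare4.Theorems

open scoped _root_.Manifold _root_.ContDiff
open Literature.Topology.FourManifolds
open Summit.SmoothPoincare4.SmoothPoincare4.Theses

/-- The route decl `CongruenceShadows.GriffithsHandlebodyExtension` is, definitionally, the
Literature named fact `Literature.Topology.FourManifolds.GriffithsExtension` (Griffiths 1964,
main theorem): the two differ only in notation (`∞` vs `((⊤ : ℕ∞) : WithTop ℕ∞)`, the
`≃ₘ⟮𝓡 2, 𝓡 2⟯` binder). [cite: GriffithsHB1964Handlebody, main theorem] -/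
theorem griffithsHandlebodyExtension_iff_griffithsExtension :
    CongruenceShadows.GriffithsHandlebodyExtension ↔ GriffithsExtension :=
  Iff.rfl

/-- The GroupTrisection copy of the route decl is the same named fact, definitionally.
[cite: GriffithsHB1964Handlebody, main theorem] -/
theorem groupTrisection_griffithsHandlebodyExtension_iff_griffithsExtension :
    GroupTrisection.GriffithsHandlebodyExtension ↔ GriffithsExtension :=
  Iff.rfl

/-- The two route copies of the item agree. [cite: GriffithsHB1964Handlebody, main theorem] -/
theorem griffithsHandlebodyExtension_iff_groupTrisection :
    CongruenceShadows.GriffithsHandlebodyExtension ↔ GroupTrisection.GriffithsHandlebodyExtension :=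
  Iff.rfl

/-- **The item from the named fact**: a discharge `GriffithsExtension_holds` of the Literature fact
closes stmt-SmoothPoincare4-15190 through this theorem (CongruenceShadows copy).
[cite: GriffithsHB1964Handlebody, main theorem] -/
theorem griffithsHandlebodyExtension_of_griffithsExtension (h : GriffithsExtension) :
    CongruenceShadows.GriffithsHandlebodyExtension :=
  h

/-- **The item from the named fact** (GroupTrisection copy).
[cite: GriffithsHB1964Handlebody, main theorem] -/
theorem groupTrisection_griffithsHandlebodyExtension_of_griffithsExtension (h : GriffithsExtension) :
    GroupTrisection.GriffithsHandlebodyExtension :=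
  h

/-- **LINE A (doubling), conditional.**  The item follows from Waldhausen's uniqueness of the
genus-`g` Heegaard splitting of `#ᵍ(S¹ × S²)` (`waldhausen_heegaardSplitting_sumS1S2_unique`,
Waldhausen 1968; Meier–Schirmer–Zupan 2016, Thm. 2.7) and the recognition of `#ᵍ(S¹ × S²)` by its
free fundamental group (`diffeomorph_sumS1S2_of_isFreeOfRank_fundamentalGroup`, Kneser–Stallings
with Perelman), both at universe `0`: glue `Y = H ∪_ψ H` and `Y₀ = H ∪_id H`, both with
`π₁ ≅ F_g`, compare the two splittings as triples, and read off an extension of `ψ`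
(`griffithsExtension_of_waldhausen_of_sumS1S2`, `HandlebodyKernelExtensionProofs.lean`).  These
two facts are exactly the inputs of crux WaldhausenPairs of this route.
[cite: GriffithsHB1964Handlebody, main theorem] [cite: MeierSchirmerZupan2016, Thm. 2.7] -/
theorem griffithsHandlebodyExtension_of_waldhausen_of_sumS1S2
    (hW : waldhausen_heegaardSplitting_sumS1S2_unique.{0})
    (hK : diffeomorph_sumS1S2_of_isFreeOfRank_fundamentalGroup.{0}) :
    CongruenceShadows.GriffithsHandlebodyExtension :=
  griffithsExtension_of_waldhausen_of_sumS1S2 hW hK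

/-- **LINE B/C, split by genus, conditional.**  The item follows from the faithfulness of the
mapping class group of the torus on `π₁` in its model form (F) — every self-diffeomorphism of the
Heegaard torus `∂V` of the round solid torus fixing `basePt` and inducing the identity of
`π₁(∂V, basePt)` is diffeotopic to the identity (Farb–Margalit (2012), Thm. 2.5; the named fact
`Literature.Topology.FourManifolds.TorusMappingClassFaithful` at one base point) — together with
Griffiths' kernel criterion on the flower handlebodies `FlowerModel.FlowerHandlebody` of genus
`g ≥ 2` with their subtype boundary data (the clause where the classical proof needs Dehn's lemma
and disc surgery, Hensel (2020), Lemma 5.10 and Cor. 5.11); genus `0` is unconditional (`Γ₃ = 0`)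
and one model per genus suffices by the classification of handlebodies
(`griffithsExtension_of_faithful_of_flower`, `HandlebodyKernelExtensionGenusOne.lean`).
[cite: Hensel2020HandlebodyPrimer, Cor. 5.11 and Lemma 5.10] [cite: FarbMargalit2012, Thm. 2.5] -/
theorem griffithsHandlebodyExtension_of_faithful_of_flower
    (hF : ∀ (τ : (𝓡∂ 3).boundary RoundSolidTorusModel.RoundSolidTorus ≃ₘ⟮𝓡 2, 𝓡 2⟯
        (𝓡∂ 3).boundary RoundSolidTorusModel.RoundSolidTorus)
      (hτ : τ RoundSolidTorusModel.basePt = RoundSolidTorusModel.basePt),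
      (∀ γ, FundamentalGroup.mapOfEq (⟨τ, τ.continuous⟩ : C(_, _)) hτ γ = γ) →
        Diffeomorph.IsDiffeotopicToId τ)
    (h₂ : ∀ (g : ℕ) (hg : 2 ≤ g)
      (χ : (BoundaryManifold.boundaryData 2 (FlowerModel.FlowerHandlebody hg)).carrier ≃ₘ⟮𝓡 2, 𝓡 2⟯
        (BoundaryManifold.boundaryData 2 (FlowerModel.FlowerHandlebody hg)).carrier)
      (y₀ : (BoundaryManifold.boundaryData 2 (FlowerModel.FlowerHandlebody hg)).carrier),
      ((FundamentalGroup.map (⟨(BoundaryManifold.boundaryData 2 (FlowerModel.FlowerHandlebody hg)).incl,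
          (BoundaryManifold.boundaryData 2 (FlowerModel.FlowerHandlebody hg)).continuous_incl⟩ :
            C((BoundaryManifold.boundaryData 2 (FlowerModel.FlowerHandlebody hg)).carrier,
              FlowerModel.FlowerHandlebody hg)) y₀).ker).map
          (FundamentalGroup.map (⟨χ, χ.continuous⟩ : C(_, _)) y₀)
        = (FundamentalGroup.map (⟨(BoundaryManifold.boundaryData 2 (FlowerModel.FlowerHandlebody hg)).incl,
            (BoundaryManifold.boundaryData 2 (FlowerModel.FlowerHandlebody hg)).continuous_incl⟩ :
              C((BoundaryManifold.boundaryData 2 (FlowerModel.FlowerHandlebody hg)).carrier,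
                FlowerModel.FlowerHandlebody hg))
            ((⟨χ, χ.continuous⟩ : C(_, _)) y₀)).ker →
      (BoundaryManifold.boundaryData 2 (FlowerModel.FlowerHandlebody hg)).DiffeoExtends χ) :
    CongruenceShadows.GriffithsHandlebodyExtension :=
  griffithsExtension_of_faithful_of_flower hF h₂

/-- **The genus-`≤ 1` clauses of the item, from (F) alone**: for a handlebody of genus `g ≤ 1`
with any boundary datum, every kernel-preserving boundary diffeomorphism extends — genus `0`
outright (`griffithsExtension_genus_zero`, `Γ₃ = 0`), genus `1` by
`griffithsExtension_genus_one_of_faithful` (lower-triangular realisation on the round solid torus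
plus the faithfulness of `Mod(T²)` in its model form (F)).  Stated with the binders of the route
decl restricted to `g ≤ 1`.
[cite: GriffithsHB1964Handlebody, main theorem (genus ≤ 1)] [cite: FarbMargalit2012, Thm. 2.5] -/
theorem griffithsHandlebodyExtension_genus_le_one_of_faithful
    (hF : ∀ (τ : (𝓡∂ 3).boundary RoundSolidTorusModel.RoundSolidTorus ≃ₘ⟮𝓡 2, 𝓡 2⟯
        (𝓡∂ 3).boundary RoundSolidTorusModel.RoundSolidTorus)
      (hτ : τ RoundSolidTorusModel.basePt = RoundSolidTorusModel.basePt),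
      (∀ γ, FundamentalGroup.mapOfEq (⟨τ, τ.continuous⟩ : C(_, _)) hτ γ = γ) →
        Diffeomorph.IsDiffeotopicToId τ)
    (g : ℕ) (hg : g ≤ 1)
    (H : Type) [TopologicalSpace H] [T2Space H] [SecondCountableTopology H]
    [ChartedSpace (EuclideanHalfSpace 3) H] [IsManifold (𝓡∂ 3) ∞ H]
    (hH : IsHandlebody g H) (b : BoundaryData (𝓡∂ 3) H (𝓡 2))
    (ψ : b.carrier ≃ₘ⟮𝓡 2, 𝓡 2⟯ b.carrier) (x₀ : b.carrier)
    (hker : ((FundamentalGroup.map (⟨b.incl, b.continuous_incl⟩ : C(b.carrier, H)) x₀).ker).map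
        (FundamentalGroup.map (⟨ψ, ψ.continuous⟩ : C(b.carrier, b.carrier)) x₀)
      = (FundamentalGroup.map (⟨b.incl, b.continuous_incl⟩ : C(b.carrier, H))
          ((⟨ψ, ψ.continuous⟩ : C(b.carrier, b.carrier)) x₀)).ker) :
    b.DiffeoExtends ψ := by
  rcases Nat.le_one_iff_eq_zero_or_eq_one.mp hg with rfl | rfl
  · exact griffithsExtension_genus_zero H hH b ψ
  · exact griffithsExtension_genus_one_of_faithful hF H hH b ψ x₀ hker

end Summit.SmoothPoincare4.SmoothPoincare4.Theorems

end
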